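import Summits.HubbardSuperconductivity.HubbardSuperconductivity.Theses.CooperPairDMottWalk
import Summits.HubbardSuperconductivity.HubbardSuperconductivity.Theorems.CooperPairDMottWalkCooperPairDMottHolonBandFloorParity
import Summits.HubbardSuperconductivity.HubbardSuperconductivity.Theorems.CooperPairDMottWalkCooperPairDMottTwoHoleGapSchur

/-!
# Route `CooperPairDMottWalk`, crux `CooperPairDMott` (stmt-HubbardSuperconductivity-1177):
# stub H (`stub_holonBandFloor`) reduced to relative-bound gap stability of the d-Mott parent

Stub H of the line `Cruxes/CooperPairDMott/Lines/birth.lean` is the one-hole threshold from below,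
uniformly in the volume: `E(L², 0) + (e₃^½ − e₄⁰) − C·b ≤ E(L²−1, ½)` for the breathing torus
`H_L(1, b, U)`, `L = 4k + 4` large, `b` small — equivalently (particle–hole symmetry) the statement that
the Mott gap of the half-filled breathing torus is at least the plaquette Mott gap minus `O(b)`. This
file proves it from TWO inputs (`holonBandFloor_of_relativeBound`):

* **(RB) relative-bound gap stability of the d-Mott parent** — the engine, taken as a hypothesis: for
  `U ∈ [2,4]` there are `c, b₀ > 0` such that for `b ∈ (0, b₀)` and `k ≥ k₀(b)` some number-conserving
  isometry `V` (the inverse spectral flow / Lie–Schwinger conjugation of Bravyi–Hastings–Michalakis,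
  Michalakis–Zwolak, Del Vecchio–Fröhlich–Pizzo–Rossi; fermionic Lieb–Robinson machinery of
  Nachtergaele–Sims–Young) satisfies, for every state `φ`,
  `(1 − c b)·[⟨Vφ, (H_intra − μN) Vφ⟩ − (L/2)²(e₄ − 4μ)‖φ‖²] − b‖φ‖² ≤ ⟨φ, (H_L − μN)φ⟩ − (E(L²,0) − μL²)‖φ‖²`
  at `μ = U/2`: the grand-canonical excitation energy of the breathing torus above its half-filled ground
  level dominates `(1 − O(b))` times the excitation energy of the DECOUPLED plaquettes, up to a dressing
  and a finite-size slack `b` (Bravyi–Hastings–Michalakis, J. Math. Phys. 51 (2010) 093512, proof of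
  Thm. 1; no printed theorem states it for interacting fermionic block parents — this is the open engine
  of the crux, registered as the stub `stub_relativeBoundDMott`);
* **(OF) the odd-sector floor of the plaquette at `μ = U/2`** — a finite-dimensional plaquette datum
  (certified computation, registered as `stub_plaquetteOddSectorFloor`): `h − μn ≥ e₄ − 4μ` on every
  `(N↑, N↓)` sector, `≥ e₃ − 3μ` on every odd sector, and `e₄ − μ < e₃`.

Proof (`holonBandFloor_of_relativeBound`): on a one-hole state `φ` (sector `(L²−1, ½)`), `Vφ` has an odd
number of electrons, so by the parity bookkeeping of `…HolonBandFloorParity`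
(`re_oddFloor_intra_of_plaquetteData`) the decoupled excitation energy of `Vφ` is at least
`θ = e₃ − 3μ − (e₄ − 4μ) > 0`; (RB) turns this into `⟨φ, H_L φ⟩ ≥ (E(L²,0) + e₃ − e₄ − (cθ + 1)b)‖φ‖²`,
and the sector energy is the infimum of such Rayleigh quotients. Constants: `C = cθ + 1`,
`b₀' = min(b₀, 1/c)`.

References: Bravyi–Hastings–Michalakis (2010); Michalakis–Zwolak, CMP 322 (2013) 277; Nachtergaele–
Sims–Young, arXiv:1705.08553; E. H. Lieb, PRL 62 (1989) 1201. No definition is introduced.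
-/

set_option linter.dupNamespace false

noncomputable section

namespace Summit.HubbardSuperconductivity.HubbardSuperconductivity.Theorems.CooperPairDMottWalk

open Matrix Finset Literature.Hubbard Literature.MathematicalPhysics.QuantumLattice Literature.Probability.LatticeModels
open scoped ComplexOrder
open Summit.HubbardSuperconductivity.HubbardSuperconductivity.Theses.CooperPairDMottWalk

/-- A number-conserving matrix maps `N`-particle vectors to `N`-particle vectors. [folklore] -/
theorem isNParticle_mulVec_of_commute {Λ : Type*} [LinearOrder Λ] [Fintype Λ]
    {V : Matrix (Finset (Orb Λ)) (Finset (Orb Λ)) ℂ} (hV : Commute V totalNumber) {N : ℕ} {φ : Fock (Orb Λ)}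
    (hφ : IsNParticle N φ) : IsNParticle N (V *ᵥ φ) := by
  rw [LiebTwo.isNParticle_iff_totalNumber] at hφ ⊢
  rw [mulVec_mulVec, ← hV.eq, ← mulVec_mulVec, hφ, mulVec_smul]

/-- The one-hole sector `((4k+4)² − 1, S^z = ½)` of the torus of side `4k + 4` is non-trivial. [folklore] -/
theorem szSector_oneHole_ne_bot (k : ℕ) :
    (szSector ((4 * k + 4) ^ 2 - 1) (1 / 2 : ℝ) : Submodule ℂ (Fock (Orb (FermionTorus 2 (4 * k + 4))))) ≠ ⊥ := by
  set a : ℕ := 8 * (k + 1) ^ 2 with ha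
  have hcard : Fintype.card (FermionTorus 2 (4 * k + 4)) = (4 * k + 4) ^ 2 := NoGo.card_fermionTorus_two _
  have haL : a ≤ Fintype.card (FermionTorus 2 (4 * k + 4)) := by rw [hcard, ha]; nlinarith
  have hbL : a - 1 ≤ Fintype.card (FermionTorus 2 (4 * k + 4)) := le_trans (Nat.sub_le _ _) haL
  obtain ⟨⟨χ, hχS, hχ0, -⟩, -⟩ := upDownSector_groundState (fermionTorusGraph 2 (4 * k + 4)) 1 0 haL hbL
  have hsum : a + (a - 1) = (4 * k + 4) ^ 2 - 1 := by rw [ha]; ring_nf; omega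
  have hdiff : (((a : ℝ) - ((a - 1 : ℕ) : ℝ)) / 2) = (1 / 2 : ℝ) := by
    have h1 : 1 ≤ a := by rw [ha]; exact Nat.one_le_iff_ne_zero.2 (by positivity)
    rw [Nat.cast_sub h1]; push_cast; ring
  have hmem : χ ∈ (szSector ((4 * k + 4) ^ 2 - 1) (1 / 2 : ℝ) : Submodule ℂ (Fock (Orb (FermionTorus 2 (4 * k + 4))))) := by
    rw [← hsum, ← hdiff]
    exact (mem_szSector_iff_isInSector a (a - 1) χ).2 hχS
  intro hbot
  rw [hbot, Submodule.mem_bot] at hmem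
  exact hχ0 hmem

/-- **Stub H from relative-bound stability and the plaquette odd-sector floor.** See the module
docstring: (RB) → (OF) → `stub_holonBandFloor` verbatim, with `C = cθ + 1`, `θ = e₃ − e₄ + U/2`,
`b₀' = min(b₀, 1/c)`. [cite: MichalakisZwolakCMP2013, Thm. 1] -/
theorem holonBandFloor_of_relativeBound :
    (let Hb := fun (L : ℕ) (a b U : ℝ) => hamiltonian (fermionTorusGraph 2 L \ (⊤ : SimpleGraph (Fin 2 → ℕ)).comap (fun (x : FermionTorus 2 L) (i : Fin 2) => (ofLex x i : ℕ) / 2)) a U + hamiltonian (fermionTorusGraph 2 L ⊓ (⊤ : SimpleGraph (Fin 2 → ℕ)).comap (fun (x : FermionTorus 2 L) (i : Fin 2) => (ofLex x i : ℕ) / 2)) b 0;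
    ∀ U ∈ Set.Icc (2 : ℝ) 4, ∃ c > (0 : ℝ), ∃ b₀ > (0 : ℝ), ∀ b ∈ Set.Ioo 0 b₀, ∃ k₀ : ℕ, ∀ k ≥ k₀,
      ∃ V : Matrix (Finset (Orb (FermionTorus 2 (4 * k + 4)))) (Finset (Orb (FermionTorus 2 (4 * k + 4)))) ℂ,
        Commute V totalNumber ∧ (∀ φ, star (V *ᵥ φ) ⬝ᵥ (V *ᵥ φ) = star φ ⬝ᵥ φ) ∧
        ∀ φ : Fock (Orb (FermionTorus 2 (4 * k + 4))),
          (1 - c * b) * ((star (V *ᵥ φ) ⬝ᵥ ((hamiltonian (fermionTorusGraph 2 (4 * k + 4) \ (⊤ : SimpleGraph (Fin 2 → ℕ)).comap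
                (fun (x : FermionTorus 2 (4 * k + 4)) (i : Fin 2) => (ofLex x i : ℕ) / 2)) 1 U
                - ((U / 2 : ℝ) : ℂ) • totalNumber) *ᵥ (V *ᵥ φ))).re
              - ((((4 * k + 4) / 2) ^ 2 : ℕ) : ℝ) * ((hubbardTorus 2 2 1 U).minEnergyOn (szSector 4 0) - 2 * U) *
                (star φ ⬝ᵥ φ).re)
            - b * (star φ ⬝ᵥ φ).re ≤
          (star φ ⬝ᵥ ((Hb (4 * k + 4) 1 b U - ((U / 2 : ℝ) : ℂ) • totalNumber) *ᵥ φ)).re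
            - ((Hb (4 * k + 4) 1 b U).minEnergyOn (szSector ((4 * k + 4) ^ 2) 0)
                - U / 2 * (((4 * k + 4) ^ 2 : ℕ) : ℝ)) * (star φ ⬝ᵥ φ).re) →
    (∀ U ∈ Set.Icc (2 : ℝ) 4,
      (∀ a b : ℕ, ∀ v : Fock (Orb (FermionTorus 2 2)), IsInSector a b v →
        ((hubbardTorus 2 2 1 U).minEnergyOn (szSector 4 0) - 2 * U) * (star v ⬝ᵥ v).re ≤
          (star v ⬝ᵥ ((hubbardTorus 2 2 1 U - ((U / 2 : ℝ) : ℂ) • totalNumber) *ᵥ v)).re) ∧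
      (∀ a b : ℕ, ¬ Even (a + b) → ∀ v : Fock (Orb (FermionTorus 2 2)), IsInSector a b v →
        ((hubbardTorus 2 2 1 U).minEnergyOn (szSector 3 (1 / 2)) - 3 * (U / 2)) * (star v ⬝ᵥ v).re ≤
          (star v ⬝ᵥ ((hubbardTorus 2 2 1 U - ((U / 2 : ℝ) : ℂ) • totalNumber) *ᵥ v)).re) ∧
      (hubbardTorus 2 2 1 U).minEnergyOn (szSector 4 0) - U / 2 <
        (hubbardTorus 2 2 1 U).minEnergyOn (szSector 3 (1 / 2))) →
    (let Hb := fun (L : ℕ) (a b U : ℝ) => hamiltonian (fermionTorusGraph 2 L \ (⊤ : SimpleGraph (Fin 2 → ℕ)).comap (fun (x : FermionTorus 2 L) (i : Fin 2) => (ofLex x i : ℕ) / 2)) a U + hamiltonian (fermionTorusGraph 2 L ⊓ (⊤ : SimpleGraph (Fin 2 → ℕ)).comap (fun (x : FermionTorus 2 L) (i : Fin 2) => (ofLex x i : ℕ) / 2)) b 0;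
    ∀ U ∈ Set.Icc (2 : ℝ) 4, ∃ C > (0 : ℝ), ∃ b₀ > (0 : ℝ), ∀ b ∈ Set.Ioo 0 b₀, ∃ k₀ : ℕ, ∀ k ≥ k₀,
      (Hb (4 * k + 4) 1 b U).minEnergyOn (szSector ((4 * k + 4) ^ 2) 0) +
          ((hubbardTorus 2 2 1 U).minEnergyOn (szSector 3 (1 / 2)) -
            (hubbardTorus 2 2 1 U).minEnergyOn (szSector 4 0)) - C * b ≤
        (Hb (4 * k + 4) 1 b U).minEnergyOn (szSector ((4 * k + 4) ^ 2 - 1) (1 / 2))) := by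
  intro hRB hD
  dsimp only at hRB ⊢
  intro U hU
  obtain ⟨c, hc, b₀, hb₀, hRBU⟩ := hRB U hU
  obtain ⟨hD0, hD1, hD3⟩ := hD U hU
  -- the holon price θ = e₃ − 3μ − (e₄ − 4μ) > 0 at μ = U/2
  have hθ : 0 < (hubbardTorus 2 2 1 U).minEnergyOn (szSector 3 (1 / 2)) - 3 * (U / 2)
      - ((hubbardTorus 2 2 1 U).minEnergyOn (szSector 4 0) - 2 * U) := by linarith
  refine ⟨c * ((hubbardTorus 2 2 1 U).minEnergyOn (szSector 3 (1 / 2)) - 3 * (U / 2)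
      - ((hubbardTorus 2 2 1 U).minEnergyOn (szSector 4 0) - 2 * U)) + 1, by positivity,
    min b₀ (1 / c), lt_min hb₀ (by positivity), fun b hb => ?_⟩
  have hb0 : 0 < b := hb.1
  have hbb₀ : b < b₀ := lt_of_lt_of_le hb.2 (min_le_left _ _)
  have hbc : b ≤ 1 / c := (lt_of_lt_of_le hb.2 (min_le_right _ _)).le
  have hcb : c * b ≤ 1 := by rw [le_div_iff₀ hc] at hbc; linarith
  obtain ⟨k₀, hk⟩ := hRBU b ⟨hb0, hbb₀⟩
  refine ⟨k₀, fun k hkk => ?_⟩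
  obtain ⟨V, hVN, hViso, hVineq⟩ := hk k hkk
  haveI : NeZero (4 * k + 4) := ⟨by omega⟩
  have hL : Even (4 * k + 4) := ⟨2 * k + 2, by ring⟩
  have h1L : 1 ≤ (4 * k + 4) ^ 2 := Nat.one_le_pow _ _ (by omega)
  have hodd : Odd ((4 * k + 4) ^ 2 - 1) := by
    refine Nat.Even.sub_odd h1L ?_ odd_one
    exact (Nat.even_pow' two_ne_zero).2 hL
  -- lower bound on every one-hole Rayleigh quotient
  refine le_minEnergyOn_of_forall _ _ (szSector_oneHole_ne_bot k) fun φ hφ => ?_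
  have hφN : IsNParticle ((4 * k + 4) ^ 2 - 1) φ := ((mem_szSector_iff _ _ φ).1 hφ).1
  have hψN : IsNParticle ((4 * k + 4) ^ 2 - 1) (V *ᵥ φ) := isNParticle_mulVec_of_commute hVN hφN
  -- the odd floor of the decoupled plaquettes on `V φ`
  have hfloor := re_oddFloor_intra_of_plaquetteData hL U hD0 hD1 (by linarith) hodd hψN
  have hiso : (star (V *ᵥ φ) ⬝ᵥ (V *ᵥ φ)).re = (star φ ⬝ᵥ φ).re := by rw [hViso φ]
  rw [hiso] at hfloor
  -- (RB) at φ
  have hRBφ := hVineq φ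
  -- the chemical potential on the one-hole sector: ⟨φ, μN φ⟩ = μ (L² − 1) ‖φ‖²
  have hNφ : totalNumber *ᵥ φ = ((((4 * k + 4) ^ 2 - 1 : ℕ) : ℂ)) • φ := (LiebTwo.isNParticle_iff_totalNumber _ φ).1 hφN
  have hμ : (star φ ⬝ᵥ ((hamiltonian (fermionTorusGraph 2 (4 * k + 4) \ (⊤ : SimpleGraph (Fin 2 → ℕ)).comap
        (fun (x : FermionTorus 2 (4 * k + 4)) (i : Fin 2) => (ofLex x i : ℕ) / 2)) 1 U +
        hamiltonian (fermionTorusGraph 2 (4 * k + 4) ⊓ (⊤ : SimpleGraph (Fin 2 → ℕ)).comap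
        (fun (x : FermionTorus 2 (4 * k + 4)) (i : Fin 2) => (ofLex x i : ℕ) / 2)) b 0
          - ((U / 2 : ℝ) : ℂ) • totalNumber) *ᵥ φ)).re =
      (star φ ⬝ᵥ ((hamiltonian (fermionTorusGraph 2 (4 * k + 4) \ (⊤ : SimpleGraph (Fin 2 → ℕ)).comap
        (fun (x : FermionTorus 2 (4 * k + 4)) (i : Fin 2) => (ofLex x i : ℕ) / 2)) 1 U +
        hamiltonian (fermionTorusGraph 2 (4 * k + 4) ⊓ (⊤ : SimpleGraph (Fin 2 → ℕ)).comap
        (fun (x : FermionTorus 2 (4 * k + 4)) (i : Fin 2) => (ofLex x i : ℕ) / 2)) b 0) *ᵥ φ)).re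
        - U / 2 * ((((4 * k + 4) ^ 2 : ℕ) : ℝ) - 1) * (star φ ⬝ᵥ φ).re := by
    rw [sub_mulVec, smul_mulVec, hNφ, smul_smul, dotProduct_sub, dotProduct_smul, smul_eq_mul, Complex.sub_re,
      show (((U / 2 : ℝ) : ℂ) * ((((4 * k + 4) ^ 2 - 1 : ℕ) : ℂ))) = ((U / 2 * ((((4 * k + 4) ^ 2 : ℕ) : ℝ) - 1) : ℝ) : ℂ) by
        rw [Nat.cast_sub h1L]; push_cast; ring,
      Complex.re_ofReal_mul]
  rw [hμ] at hRBφ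
  have hnn : 0 ≤ (star φ ⬝ᵥ φ).re := (Complex.nonneg_iff.1 (dotProduct_star_self_nonneg φ)).1
  have h1cb : 0 ≤ 1 - c * b := by linarith
  -- combine: (1 − cb)·θ‖φ‖² − b‖φ‖² ≤ ⟨φ,Hφ⟩ − μ(L²−1)‖φ‖² − (E₀ − μL²)‖φ‖²
  nlinarith [mul_le_mul_of_nonneg_left hfloor h1cb, mul_nonneg hc.le hθ.le]

end Summit.HubbardSuperconductivity.HubbardSuperconductivity.Theorems.CooperPairDMottWalk

end
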